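import Literature.NumberTheory.EllipticCurves.EichlerIntegralPolesProofs
import Mathlib.Analysis.Analytic.IsolatedZeros
import HarnessLib

/-!
# Cusp values of modular parametrisations along `SL₂(ℤ)`-translates: the leading-coefficient lemma
(route `ManinLocalTwoThree`, crux C2 `ManinOddAtFour` stmt-BirchSwinnertonDyer-22967; cell bsd-f2-manin, prover seat p2 gen 23;
`--supports stmt-BirchSwinnertonDyer-22967`; analytic core of STEP (2) of the LEAD's road to the printed fact T-es-75
`optimalGamma1Parametrization_cuspInv_galoisAction` (Stevens 1982 Thm. 1.3.1 (b)); no Galois theory inside)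

The value of a modular parametrisation `φ(τ) = π(c·2πi∫_{i∞}^τ f)` at the cusp `g∞` (`g ∈ SL₂(ℤ)`, `g∞ = a/c ∈ ℚ`) is
`π(c·{∞, g∞}_f)`; its coordinates are the limits of `℘_Λ(c·ℰ_f(gτ))`, `℘_Λ'(c·ℰ_f(gτ))` as `im τ → ∞`, and these limits are read
off the `q_N`-expansions of the translated presenting forms.  THIS FILE proves the analysis:

* §1 `tendsto_eichlerIntegral_smul_atImInfty` — `ℰ_f(gτ) → {∞, g∞}_f` as `im τ → ∞` (`modularSymbol_smul_infty`: `ℰ_f(gτ) = {∞,g∞} + V_{f∣g}(τ)`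
  and `V_{f∣g} → 0`, `tendsto_verticalIntegral_of_im`).
* §2 THE LEADING-COEFFICIENT LEMMA (pure complex analysis at `0`, along any filter): if `g₁ = r·g₂` along points `q_i → 0`, `q_i ≠ 0`,
  with `g₁, g₂` given by power series `p₁, p₂ ≠ 0` at `0` and `r_i → x₀`, then `p₁` vanishes below `m := ord p₂` and
  `coeff_m p₁ = x₀ · coeff_m p₂` (`coeff_eq_of_tendsto_mul`); if instead `‖r_i‖ → ∞` then `ord p₁ < ord p₂`
  (`order_lt_of_tendsto_norm_atTop`).
* §3 the `q_N`-expansion form on `ℍ` (`qExpansion_coeff_eq_of_tendsto_mul`, `qExpansion_order_lt_of_tendsto_norm_atTop`): for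
  `N`-periodic `Φ, Ψ : ℍ → ℂ` with analytic cusp functions (e.g. members of `formSpace Γ(N) k`, such as `F ∣[k] g`, `G ∣[k] g`),
  `Φ = r·Ψ` eventually at `i∞` with `r → x₀` forces `coeff_n(Φ) = 0` for `n < m` and `coeff_m(Φ) = x₀·coeff_m(Ψ)`, where `m` is the
  first non-vanishing coefficient of `Ψ`.
* §4 presentations: if `G·℘_Λ(c·ℰ_f) = F` off the poles, then along `g` with `z₀ = c·{∞,g∞}_f ∉ Λ`:
  `coeff_m(F∣g) = ℘_Λ(z₀)·coeff_m(G∣g)` (`qExpansion_coeff_eq_weierstrassP_mul_of_presentation`; any `w` continuous at `z₀` in place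
  of `℘_Λ`: `qExpansion_coeff_eq_apply_mul_of_presentation`; `℘_Λ'`: `…derivWeierstrassP…`), the shape consumed by a Galois action on
  `q_N`-coefficients of translates (the translates `F ∣[k] g`, `G ∣[k] g` enter as `N`-periodic functions with analytic cusp functions).

Fact-free; nothing about T-es-75, C2, Manin's conjecture or BSD is proved here.  No definitions, no sorry.
[cite: Manin1972, Prop. 1.4 and §1.5] [cite: ShimuraIATAF1971, §6.1–6.2] [cite: DiamondShurman2005, §1.1–1.2]
-/

set_option autoImplicit false
-- lint-debt: the directory name repeats the summit name (sibling precedent `ManinLocalTwoThreeKummerValuesHalfIndex.lean`)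
set_option linter.dupNamespace false

noncomputable section

open scoped MatrixGroups ModularForm Topology PeriodPair
open Complex Filter Function CongruenceSubgroup
open UpperHalfPlane hiding I
open Literature.NumberTheory.EllipticCurves Literature.NumberTheory.EllipticCurves.ModularForms

namespace Summit.BirchSwinnertonDyer.BirchSwinnertonDyer.Theorems.ManinLocalTwoThree.CuspValues

/-! ## §1 The Eichler integral at a translate tends to the cusp value -/

/-- **`ℰ_f(gτ) → {∞, g∞}_f` as `im τ → ∞`** for `g ∈ SL₂(ℤ)` with `g∞ ≠ ∞`: `ℰ_f(gτ) = {∞, g∞}_f + V_{f∣g}(τ)`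
(`modularSymbol_smul_infty`) and the cuspidal `q_N`-series integral `V_{f∣g}(τ) → 0` (`tendsto_verticalIntegral_of_im`).
[cite: Manin1972, Prop. 1.4 and §1.5] -/
theorem tendsto_eichlerIntegral_smul_atImInfty {N : ℕ} [NeZero N] (f : CuspForm (Gamma0 N) 2) (g : SL(2, ℤ))
    (hg : (g 1 0 : ℤ) ≠ 0) :
    Tendsto (fun τ : ℍ ↦ eichlerIntegral f (g • τ)) atImInfty
      (𝓝 (modularSymbol f (((g 0 0 : ℤ) : ℚ) / ((g 1 0 : ℤ) : ℚ)))) := by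
  -- `V_{f∣g}(τ) → 0` high in the cusp (`IsCuspFunction.exists_forall_norm_verticalIntegral_le`)
  have hV : Tendsto (fun τ : ℍ ↦ verticalIntegral (⇑f ∣[(2 : ℤ)] g) τ) atImInfty (𝓝 0) := by
    rw [Metric.tendsto_nhds]
    intro ε hε
    obtain ⟨M, hM⟩ := (isCuspFunction_slash f g).exists_forall_norm_verticalIntegral_le (half_pos hε)
    rw [Filter.Eventually, UpperHalfPlane.atImInfty_mem]
    exact ⟨M, fun τ hτ ↦ by
      rw [Set.mem_setOf_eq, dist_zero_right]
      exact (hM τ hτ).trans_lt (half_lt_self hε)⟩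
  have heq : (fun τ : ℍ ↦ eichlerIntegral f (g • τ)) =
      fun τ ↦ modularSymbol f (((g 0 0 : ℤ) : ℚ) / ((g 1 0 : ℤ) : ℚ)) + verticalIntegral (⇑f ∣[(2 : ℤ)] g) τ := by
    funext τ; rw [modularSymbol_smul_infty f g hg τ]; ring
  rw [heq]
  simpa using hV.const_add (modularSymbol f (((g 0 0 : ℤ) : ℚ) / ((g 1 0 : ℤ) : ℚ)))

/-! ## §2 The leading-coefficient lemma (power series at `0`, along a filter) -/

section Core

variable {ι : Type*} {l : Filter ι} {q : ι → ℂ}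

/-- The `n`-th iterated `dslope` of `g` at `0` is the `n`-th coefficient of its power series. [folklore] -/
theorem iterate_dslope_apply_eq_coeff {g : ℂ → ℂ} {p : FormalMultilinearSeries ℂ ℂ ℂ} (hp : HasFPowerSeriesAt g p 0) (n : ℕ) :
    (swap dslope (0 : ℂ))^[n] g 0 = p.coeff n := by
  rw [← (hp.has_fpower_series_iterate_dslope_fslope n).coeff_zero 1]
  change (FormalMultilinearSeries.fslope^[n] p).coeff 0 = p.coeff n
  rw [FormalMultilinearSeries.coeff_iterate_fslope, zero_add]

/-- `g(q_i) / q_i^{ord} → coeff_{ord}` along any `q_i → 0`. [folklore] -/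
theorem tendsto_iterate_dslope {g : ℂ → ℂ} {p : FormalMultilinearSeries ℂ ℂ ℂ} (hp : HasFPowerSeriesAt g p 0) (n : ℕ)
    (hq : Tendsto q l (𝓝 0)) :
    Tendsto (fun i ↦ (swap dslope (0 : ℂ))^[n] g (q i)) l (𝓝 (p.coeff n)) := by
  rw [← iterate_dslope_apply_eq_coeff hp n]
  exact (hp.has_fpower_series_iterate_dslope_fslope n).continuousAt.tendsto.comp hq

/-- The factorisation `g z = z^{ord p} · D(z)` with `D` the iterated `dslope`. [folklore] -/
theorem eq_pow_order_mul {g : ℂ → ℂ} {p : FormalMultilinearSeries ℂ ℂ ℂ} (hp : HasFPowerSeriesAt g p 0) (z : ℂ) :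
    g z = z ^ p.order * (swap dslope (0 : ℂ))^[p.order] g z := by
  have h := hp.eq_pow_order_mul_iterate_dslope z
  rwa [sub_zero, smul_eq_mul] at h

/-- The coefficient at the order is nonzero. [folklore] -/
theorem coeff_order_ne_zero {p : FormalMultilinearSeries ℂ ℂ ℂ} (hp : p ≠ 0) : p.coeff p.order ≠ 0 := fun h ↦
  p.apply_order_ne_zero hp (FormalMultilinearSeries.coeff_eq_zero.mp h)

/-- **THE LEADING-COEFFICIENT LEMMA.**  Let `g₁, g₂ : ℂ → ℂ` have power series `p₁, p₂` at `0`, `p₂ ≠ 0` with order `m`, and let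
`q_i → 0`, `q_i ≠ 0` along a filter with `g₁(q_i) = r_i·g₂(q_i)` and `r_i → x₀`.  Then `p₁` vanishes in degrees `< m` and
`coeff_m p₁ = x₀ · coeff_m p₂`. [folklore] -/
theorem coeff_eq_of_tendsto_mul [l.NeBot] {g₁ g₂ : ℂ → ℂ} {p₁ p₂ : FormalMultilinearSeries ℂ ℂ ℂ}
    (h₁ : HasFPowerSeriesAt g₁ p₁ 0) (h₂ : HasFPowerSeriesAt g₂ p₂ 0) (hp₂ : p₂ ≠ 0)
    (hq : Tendsto q l (𝓝 0)) (hq0 : ∀ᶠ i in l, q i ≠ 0)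
    {r : ι → ℂ} {x₀ : ℂ} (hr : Tendsto r l (𝓝 x₀)) (hfac : ∀ᶠ i in l, g₁ (q i) = r i * g₂ (q i)) :
    (∀ n < p₂.order, p₁.coeff n = 0) ∧ p₁.coeff p₂.order = x₀ * p₂.coeff p₂.order := by
  set m := p₂.order with hm
  have hβ : p₂.coeff m ≠ 0 := coeff_order_ne_zero hp₂
  have hD₂ := tendsto_iterate_dslope h₂ m hq
  -- the limit of `r · D₂(q)` is `x₀ β`
  have hlim : Tendsto (fun i ↦ r i * (swap dslope (0 : ℂ))^[m] g₂ (q i)) l (𝓝 (x₀ * p₂.coeff m)) := hr.mul hD₂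
  have hfac' : ∀ᶠ i in l, g₁ (q i) = r i * ((q i) ^ m * (swap dslope (0 : ℂ))^[m] g₂ (q i)) := by
    filter_upwards [hfac] with i hi
    rw [hi, ← eq_pow_order_mul h₂]
  by_cases hp₁ : p₁ = 0
  · -- `g₁ ≡ 0` near `0`: then `x₀ β = 0`
    subst hp₁
    have hz : ∀ᶠ i in l, g₁ (q i) = 0 := hq.eventually h₁.eventually_eq_zero
    have h0 : ∀ᶠ i in l, r i * (swap dslope (0 : ℂ))^[m] g₂ (q i) = 0 := by
      filter_upwards [hz, hfac', hq0] with i hi hi' hqi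
      have h' : r i * ((q i) ^ m * (swap dslope (0 : ℂ))^[m] g₂ (q i)) = 0 := hi'.symm.trans hi
      rcases mul_eq_zero.mp h' with h0 | h0
      · rw [h0, zero_mul]
      · rw [(mul_eq_zero.mp h0).resolve_left (pow_ne_zero _ hqi), mul_zero]
    have hx : x₀ * p₂.coeff m = 0 := tendsto_nhds_unique hlim (tendsto_const_nhds.congr' (h0.mono fun i hi ↦ hi.symm))
    exact ⟨fun n _ ↦ by simp [FormalMultilinearSeries.coeff], by rw [hx]; simp [FormalMultilinearSeries.coeff]⟩
  · set n₁ := p₁.order with hn₁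
    have hα : p₁.coeff n₁ ≠ 0 := coeff_order_ne_zero hp₁
    have hD₁ := tendsto_iterate_dslope h₁ n₁ hq
    have hrel : ∀ᶠ i in l, (q i) ^ n₁ * (swap dslope (0 : ℂ))^[n₁] g₁ (q i) =
        r i * ((q i) ^ m * (swap dslope (0 : ℂ))^[m] g₂ (q i)) := by
      filter_upwards [hfac'] with i hi
      rw [← eq_pow_order_mul h₁, hi]
    rcases lt_trichotomy n₁ m with hlt | heq | hgt
    · -- `n₁ < m`: `D₁(q) = r q^{m-n₁} D₂(q) → 0`, contradicting `α ≠ 0`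
      exfalso
      obtain ⟨d, hd⟩ := Nat.exists_eq_add_of_lt hlt
      have hrel' : ∀ᶠ i in l, (swap dslope (0 : ℂ))^[n₁] g₁ (q i) =
          (r i * (swap dslope (0 : ℂ))^[m] g₂ (q i)) * (q i) ^ (d + 1) := by
        filter_upwards [hrel, hq0] with i hi hqi
        have hq' : (q i) ^ n₁ ≠ 0 := pow_ne_zero _ hqi
        apply mul_left_cancel₀ hq'
        rw [hi, hd]; ring
      have hpow : Tendsto (fun i ↦ (q i) ^ (d + 1)) l (𝓝 0) := by
        simpa using hq.pow (d + 1)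
      have h0 : Tendsto (fun i ↦ (swap dslope (0 : ℂ))^[n₁] g₁ (q i)) l (𝓝 0) := by
        have := hlim.mul hpow
        rw [mul_zero] at this
        exact this.congr' (hrel'.mono fun i hi ↦ hi.symm)
      exact hα (tendsto_nhds_unique hD₁ h0)
    · -- `n₁ = m`: `D₁(q) = r D₂(q)` ⟹ `α = x₀ β`
      refine ⟨fun n hn ↦ ?_, ?_⟩
      · exact FormalMultilinearSeries.coeff_eq_zero.mpr (p₁.apply_eq_zero_of_lt_order (by rw [← hn₁, heq]; exact hn))
      · have hrel' : ∀ᶠ i in l, (swap dslope (0 : ℂ))^[n₁] g₁ (q i) = r i * (swap dslope (0 : ℂ))^[m] g₂ (q i) := by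
          filter_upwards [hrel, hq0] with i hi hqi
          have hq' : (q i) ^ n₁ ≠ 0 := pow_ne_zero _ hqi
          apply mul_left_cancel₀ hq'
          rw [hi, heq]; ring
        have key := tendsto_nhds_unique hD₁ (hlim.congr' (hrel'.mono fun i hi ↦ hi.symm))
        rw [heq] at key
        exact key
    · -- `n₁ > m`: `r D₂(q) = q^{n₁-m} D₁(q) → 0` ⟹ `x₀ = 0`
      obtain ⟨d, hd⟩ := Nat.exists_eq_add_of_lt hgt
      have hrel' : ∀ᶠ i in l, r i * (swap dslope (0 : ℂ))^[m] g₂ (q i) =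
          (swap dslope (0 : ℂ))^[n₁] g₁ (q i) * (q i) ^ (d + 1) := by
        filter_upwards [hrel, hq0] with i hi hqi
        have hq' : (q i) ^ m ≠ 0 := pow_ne_zero _ hqi
        apply mul_left_cancel₀ hq'
        rw [show (q i) ^ m * (r i * (swap dslope (0 : ℂ))^[m] g₂ (q i)) = (q i) ^ n₁ * (swap dslope (0 : ℂ))^[n₁] g₁ (q i) by
          rw [hi]; ring, hd]
        ring
      have hpow : Tendsto (fun i ↦ (q i) ^ (d + 1)) l (𝓝 0) := by simpa using hq.pow (d + 1)
      have h0 : Tendsto (fun i ↦ r i * (swap dslope (0 : ℂ))^[m] g₂ (q i)) l (𝓝 0) := by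
        have := hD₁.mul hpow
        rw [mul_zero] at this
        exact this.congr' (hrel'.mono fun i hi ↦ hi.symm)
      have hx : x₀ * p₂.coeff m = 0 := tendsto_nhds_unique hlim h0
      refine ⟨fun n hn ↦ ?_, ?_⟩
      · exact FormalMultilinearSeries.coeff_eq_zero.mpr (p₁.apply_eq_zero_of_lt_order (lt_trans hn (by rw [← hn₁]; exact hgt)))
      · rw [hx]
        exact FormalMultilinearSeries.coeff_eq_zero.mpr (p₁.apply_eq_zero_of_lt_order (by rw [← hn₁]; exact hgt))

/-- **The pole case.**  Same setting, but `‖r_i‖ → ∞`: then `p₁ ≠ 0` and `ord p₁ < ord p₂`. [folklore] -/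
theorem order_lt_of_tendsto_norm_atTop [l.NeBot] {g₁ g₂ : ℂ → ℂ} {p₁ p₂ : FormalMultilinearSeries ℂ ℂ ℂ}
    (h₁ : HasFPowerSeriesAt g₁ p₁ 0) (h₂ : HasFPowerSeriesAt g₂ p₂ 0) (hp₂ : p₂ ≠ 0)
    (hq : Tendsto q l (𝓝 0)) (hq0 : ∀ᶠ i in l, q i ≠ 0)
    {r : ι → ℂ} (hr : Tendsto (fun i ↦ ‖r i‖) l atTop) (hfac : ∀ᶠ i in l, g₁ (q i) = r i * g₂ (q i)) :
    p₁ ≠ 0 ∧ p₁.order < p₂.order := by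
  set m := p₂.order with hm
  have hβ : p₂.coeff m ≠ 0 := coeff_order_ne_zero hp₂
  have hD₂ := tendsto_iterate_dslope h₂ m hq
  -- `‖r · D₂(q)‖ → ∞`
  have hnormD₂ : ∀ᶠ i in l, ‖p₂.coeff m‖ / 2 ≤ ‖(swap dslope (0 : ℂ))^[m] g₂ (q i)‖ := by
    have hpos : 0 < ‖p₂.coeff m‖ / 2 := by positivity
    have := (hD₂.norm).eventually (Ici_mem_nhds (show ‖p₂.coeff m‖ / 2 < ‖p₂.coeff m‖ by linarith [norm_pos_iff.mpr hβ]))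
    exact this
  have htop : Tendsto (fun i ↦ ‖r i * (swap dslope (0 : ℂ))^[m] g₂ (q i)‖) l atTop := by
    have hpos : 0 < ‖p₂.coeff m‖ / 2 := by have := norm_pos_iff.mpr hβ; positivity
    refine tendsto_atTop_mono' l ?_ (hr.atTop_mul_const hpos)
    filter_upwards [hnormD₂] with i hi
    rw [norm_mul]
    exact mul_le_mul_of_nonneg_left hi (norm_nonneg _)
  have hfac' : ∀ᶠ i in l, g₁ (q i) = (q i) ^ m * (r i * (swap dslope (0 : ℂ))^[m] g₂ (q i)) := by
    filter_upwards [hfac] with i hi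
    rw [hi, eq_pow_order_mul h₂ (q i), ← hm]; ring
  by_cases hp₁ : p₁ = 0
  · exfalso
    subst hp₁
    have hz : ∀ᶠ i in l, g₁ (q i) = 0 := hq.eventually h₁.eventually_eq_zero
    have h0 : ∀ᶠ i in l, ‖r i * (swap dslope (0 : ℂ))^[m] g₂ (q i)‖ = 0 := by
      filter_upwards [hz, hfac', hq0] with i hi hi' hqi
      rw [hi] at hi'
      rw [(mul_eq_zero.mp hi'.symm).resolve_left (pow_ne_zero _ hqi), norm_zero]
    have := htop.congr' h0
    exact absurd this (not_tendsto_const_atTop _ _)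
  · refine ⟨hp₁, ?_⟩
    set n₁ := p₁.order with hn₁
    have hD₁ := tendsto_iterate_dslope h₁ n₁ hq
    by_contra hge
    push Not at hge
    obtain ⟨d, hd⟩ := Nat.exists_eq_add_of_le hge
    -- `r D₂(q) = q^d D₁(q)` is bounded
    have hrel : ∀ᶠ i in l, r i * (swap dslope (0 : ℂ))^[m] g₂ (q i) = (q i) ^ d * (swap dslope (0 : ℂ))^[n₁] g₁ (q i) := by
      filter_upwards [hfac', hq0] with i hi hqi
      have hq' : (q i) ^ m ≠ 0 := pow_ne_zero _ hqi
      apply mul_left_cancel₀ hq'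
      rw [← hi, eq_pow_order_mul h₁ (q i), ← hn₁, hd]; ring
    have hbdd : Tendsto (fun i ↦ (q i) ^ d * (swap dslope (0 : ℂ))^[n₁] g₁ (q i)) l (𝓝 ((0 : ℂ) ^ d * p₁.coeff n₁)) :=
      (hq.pow d).mul hD₁
    have := (htop.congr' (hrel.mono fun i hi ↦ by rw [hi]))
    exact not_tendsto_atTop_of_tendsto_nhds hbdd.norm this

end Core

/-! ## §3 The `q_N`-expansion form on `ℍ` -/

section UpperHalfPlane

variable {h : ℝ}

/-- The cusp function of a periodic `Φ` with analytic cusp function has the `q`-expansion as power series at `0`. [folklore] -/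
theorem hasFPowerSeriesAt_cuspFunction {Φ : ℍ → ℂ} (hΦ : AnalyticAt ℂ (cuspFunction h Φ) 0) :
    HasFPowerSeriesAt (cuspFunction h Φ) (FormalMultilinearSeries.ofScalars ℂ fun n ↦ (qExpansion h Φ).coeff n) 0 := by
  simpa [qExpansion_coeff, div_eq_mul_inv, mul_comm] using hΦ.hasFPowerSeriesAt

/-- `q_h(τ) → 0`, `q_h(τ) ≠ 0` along `atImInfty`. [folklore] -/
theorem qParam_ne_zero (τ : ℍ) : Periodic.qParam h τ ≠ 0 := Complex.exp_ne_zero _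

/-- **Leading coefficients on `ℍ`.**  Let `Φ, Ψ : ℍ → ℂ` be `h`-periodic with analytic cusp functions (`h > 0`), let `m` be the first
non-vanishing `q_h`-coefficient of `Ψ`, and suppose `Φ = r·Ψ` eventually at `i∞` with `r → x₀`.  Then `coeff_n(Φ) = 0` for `n < m` and
`coeff_m(Φ) = x₀ · coeff_m(Ψ)`. [folklore] -/
theorem qExpansion_coeff_eq_of_tendsto_mul (hh : 0 < h) {Φ Ψ : ℍ → ℂ}
    (hΦp : Periodic (Φ ∘ ofComplex) h) (hΦa : AnalyticAt ℂ (cuspFunction h Φ) 0)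
    (hΨp : Periodic (Ψ ∘ ofComplex) h) (hΨa : AnalyticAt ℂ (cuspFunction h Ψ) 0)
    {m : ℕ} (hΨm : (qExpansion h Ψ).coeff m ≠ 0) (hΨlt : ∀ n < m, (qExpansion h Ψ).coeff n = 0)
    {r : ℍ → ℂ} {x₀ : ℂ} (hr : Tendsto r atImInfty (𝓝 x₀)) (hfac : ∀ᶠ τ in atImInfty, Φ τ = r τ * Ψ τ) :
    (∀ n < m, (qExpansion h Φ).coeff n = 0) ∧ (qExpansion h Φ).coeff m = x₀ * (qExpansion h Ψ).coeff m := by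
  classical
  have h₁ := hasFPowerSeriesAt_cuspFunction hΦa
  have h₂ := hasFPowerSeriesAt_cuspFunction hΨa
  set p₂ := FormalMultilinearSeries.ofScalars ℂ (fun n ↦ (qExpansion h Ψ).coeff n) with hp₂def
  have hcoeff₂ : ∀ n, p₂.coeff n = (qExpansion h Ψ).coeff n := fun n ↦ by
    rw [hp₂def, FormalMultilinearSeries.coeff_ofScalars]
  have hp₂ : p₂ ≠ 0 := by
    intro h0
    apply hΨm
    rw [← hcoeff₂, h0]
    simp [FormalMultilinearSeries.coeff]
  -- the order of `p₂` is `m`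
  have hord : p₂.order = m := by
    rw [FormalMultilinearSeries.order_eq_find' hp₂]
    rw [Nat.find_eq_iff]
    refine ⟨fun h0 ↦ hΨm ?_, fun n hn h0 ↦ h0 ?_⟩
    · rw [← hcoeff₂]
      exact FormalMultilinearSeries.coeff_eq_zero.mpr h0
    · exact FormalMultilinearSeries.coeff_eq_zero.mp (by rw [hcoeff₂]; exact hΨlt n hn)
  have hq : Tendsto (fun τ : ℍ ↦ Periodic.qParam h τ) atImInfty (𝓝 0) := qParam_tendsto_atImInfty hh
  have hq0 : ∀ᶠ τ : ℍ in atImInfty, Periodic.qParam h τ ≠ 0 := Eventually.of_forall qParam_ne_zero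
  have hfac' : ∀ᶠ τ : ℍ in atImInfty, cuspFunction h Φ (Periodic.qParam h τ) = r τ * cuspFunction h Ψ (Periodic.qParam h τ) := by
    filter_upwards [hfac] with τ hτ
    rw [eq_cuspFunction τ hh.ne' hΦp, eq_cuspFunction τ hh.ne' hΨp, hτ]
  obtain ⟨hlow, htop⟩ := coeff_eq_of_tendsto_mul h₁ h₂ hp₂ hq hq0 hr hfac'
  rw [hord] at hlow htop
  have hcoeff₁ : ∀ n, (FormalMultilinearSeries.ofScalars ℂ fun n ↦ (qExpansion h Φ).coeff n).coeff n = (qExpansion h Φ).coeff n :=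
    fun n ↦ by rw [FormalMultilinearSeries.coeff_ofScalars]
  refine ⟨fun n hn ↦ ?_, ?_⟩
  · rw [← hcoeff₁]; exact hlow n hn
  · rw [← hcoeff₁, ← hcoeff₂]; exact htop

/-- **The pole case on `ℍ`**: if `Φ = r·Ψ` eventually at `i∞` with `‖r‖ → ∞`, then some `q_h`-coefficient of `Φ` below the first
non-vanishing coefficient of `Ψ` is nonzero. [folklore] -/
theorem qExpansion_exists_coeff_ne_zero_of_tendsto_norm_atTop (hh : 0 < h) {Φ Ψ : ℍ → ℂ}
    (hΦp : Periodic (Φ ∘ ofComplex) h) (hΦa : AnalyticAt ℂ (cuspFunction h Φ) 0)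
    (hΨp : Periodic (Ψ ∘ ofComplex) h) (hΨa : AnalyticAt ℂ (cuspFunction h Ψ) 0)
    {m : ℕ} (hΨm : (qExpansion h Ψ).coeff m ≠ 0) (hΨlt : ∀ n < m, (qExpansion h Ψ).coeff n = 0)
    {r : ℍ → ℂ} (hr : Tendsto (fun τ ↦ ‖r τ‖) atImInfty atTop) (hfac : ∀ᶠ τ in atImInfty, Φ τ = r τ * Ψ τ) :
    ∃ n < m, (qExpansion h Φ).coeff n ≠ 0 := by
  classical
  have h₁ := hasFPowerSeriesAt_cuspFunction hΦa
  have h₂ := hasFPowerSeriesAt_cuspFunction hΨa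
  set p₁ := FormalMultilinearSeries.ofScalars ℂ (fun n ↦ (qExpansion h Φ).coeff n) with hp₁def
  have hcoeff₁ : ∀ n, p₁.coeff n = (qExpansion h Φ).coeff n := fun n ↦ by
    rw [hp₁def, FormalMultilinearSeries.coeff_ofScalars]
  set p₂ := FormalMultilinearSeries.ofScalars ℂ (fun n ↦ (qExpansion h Ψ).coeff n) with hp₂def
  have hcoeff₂ : ∀ n, p₂.coeff n = (qExpansion h Ψ).coeff n := fun n ↦ by
    rw [hp₂def, FormalMultilinearSeries.coeff_ofScalars]
  have hp₂ : p₂ ≠ 0 := by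
    intro h0
    apply hΨm
    rw [← hcoeff₂, h0]
    simp [FormalMultilinearSeries.coeff]
  have hord : p₂.order = m := by
    rw [FormalMultilinearSeries.order_eq_find' hp₂]
    rw [Nat.find_eq_iff]
    refine ⟨fun h0 ↦ hΨm ?_, fun n hn h0 ↦ h0 ?_⟩
    · rw [← hcoeff₂]
      exact FormalMultilinearSeries.coeff_eq_zero.mpr h0
    · exact FormalMultilinearSeries.coeff_eq_zero.mp (by rw [hcoeff₂]; exact hΨlt n hn)
  have hq : Tendsto (fun τ : ℍ ↦ Periodic.qParam h τ) atImInfty (𝓝 0) := qParam_tendsto_atImInfty hh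
  have hq0 : ∀ᶠ τ : ℍ in atImInfty, Periodic.qParam h τ ≠ 0 := Eventually.of_forall qParam_ne_zero
  have hfac' : ∀ᶠ τ : ℍ in atImInfty, cuspFunction h Φ (Periodic.qParam h τ) = r τ * cuspFunction h Ψ (Periodic.qParam h τ) := by
    filter_upwards [hfac] with τ hτ
    rw [eq_cuspFunction τ hh.ne' hΦp, eq_cuspFunction τ hh.ne' hΨp, hτ]
  obtain ⟨hp₁, hlt⟩ := order_lt_of_tendsto_norm_atTop h₁ h₂ hp₂ hq hq0 hr hfac'
  rw [hord] at hlt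
  refine ⟨p₁.order, hlt, ?_⟩
  rw [← hcoeff₁]
  exact coeff_order_ne_zero hp₁

end UpperHalfPlane

/-! ## §4 Presentations `Ψ·w(c·ℰ_f(g·)) = Φ` along a translate `g` -/

section Presentation

variable {N : ℕ} [NeZero N] {h : ℝ}

/-- **Cusp values along a translate, coefficient form.**  Let `Φ, Ψ : ℍ → ℂ` be `h`-periodic with analytic cusp functions (think
`Φ = F ∣[k] g`, `Ψ = G ∣[k] g` for presenting forms `F, G` of level `Γ₁(N)` and `h = N`), `g ∈ SL₂(ℤ)` with `g∞ ≠ ∞`, `w : ℂ → ℂ`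
continuous at `z₀ := c·{∞, g∞}_f`, and suppose the translated presentation `Ψ(τ)·w(c·ℰ_f(gτ)) = Φ(τ)` eventually at `i∞`.  If `m`
is the first non-vanishing `q_h`-coefficient of `Ψ`, then `coeff_n(Φ) = 0` for `n < m` and `coeff_m(Φ) = w(z₀)·coeff_m(Ψ)`.
(With `w = ℘_Λ`, `℘_Λ'` off the lattice: the coordinates of the cusp value `π(c·{∞,g∞}_f)`, below.)  Fact-free.
[cite: Manin1972, Prop. 1.4 and §1.5] [cite: ShimuraIATAF1971, §6.1–6.2] -/
theorem qExpansion_coeff_eq_apply_mul_of_presentation (hh : 0 < h) (f : CuspForm (Gamma0 N) 2)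
    (g : SL(2, ℤ)) (hg : (g 1 0 : ℤ) ≠ 0) (c : ℂ) {w : ℂ → ℂ}
    (hw : ContinuousAt w (c * modularSymbol f (((g 0 0 : ℤ) : ℚ) / ((g 1 0 : ℤ) : ℚ))))
    {Φ Ψ : ℍ → ℂ} (hΦp : Periodic (Φ ∘ ofComplex) h) (hΦa : AnalyticAt ℂ (cuspFunction h Φ) 0)
    (hΨp : Periodic (Ψ ∘ ofComplex) h) (hΨa : AnalyticAt ℂ (cuspFunction h Ψ) 0)
    (hpres : ∀ᶠ τ : ℍ in atImInfty, Ψ τ * w (c * eichlerIntegral f (g • τ)) = Φ τ)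
    {m : ℕ} (hΨm : (qExpansion h Ψ).coeff m ≠ 0) (hΨlt : ∀ n < m, (qExpansion h Ψ).coeff n = 0) :
    (∀ n < m, (qExpansion h Φ).coeff n = 0) ∧
      (qExpansion h Φ).coeff m = w (c * modularSymbol f (((g 0 0 : ℤ) : ℚ) / ((g 1 0 : ℤ) : ℚ))) * (qExpansion h Ψ).coeff m := by
  have hr : Tendsto (fun τ : ℍ ↦ w (c * eichlerIntegral f (g • τ))) atImInfty
      (𝓝 (w (c * modularSymbol f (((g 0 0 : ℤ) : ℚ) / ((g 1 0 : ℤ) : ℚ))))) :=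
    hw.tendsto.comp ((tendsto_eichlerIntegral_smul_atImInfty f g hg).const_mul c)
  exact qExpansion_coeff_eq_of_tendsto_mul hh hΦp hΦa hΨp hΨa hΨm hΨlt hr (hpres.mono fun τ hτ ↦ by rw [← hτ, mul_comm])

/-- **The `x`-coordinate of the cusp value**: with `w = ℘_Λ` and `z₀ = c·{∞,g∞}_f ∉ Λ`, a translated presentation
`Ψ·℘_Λ(c·ℰ_f(g·)) = Φ` near `i∞` gives `coeff_m(Φ) = ℘_Λ(z₀)·coeff_m(Ψ)` and the vanishing below `m`.  Fact-free.
[cite: Manin1972, Prop. 1.4 and §1.5] [cite: ShimuraIATAF1971, §6.1–6.2] -/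
theorem qExpansion_coeff_eq_weierstrassP_mul_of_presentation (hh : 0 < h) (f : CuspForm (Gamma0 N) 2) (L : PeriodPair)
    (g : SL(2, ℤ)) (hg : (g 1 0 : ℤ) ≠ 0) (c : ℂ)
    (hz₀ : c * modularSymbol f (((g 0 0 : ℤ) : ℚ) / ((g 1 0 : ℤ) : ℚ)) ∉ L.lattice)
    {Φ Ψ : ℍ → ℂ} (hΦp : Periodic (Φ ∘ ofComplex) h) (hΦa : AnalyticAt ℂ (cuspFunction h Φ) 0)
    (hΨp : Periodic (Ψ ∘ ofComplex) h) (hΨa : AnalyticAt ℂ (cuspFunction h Ψ) 0)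
    (hpres : ∀ᶠ τ : ℍ in atImInfty, Ψ τ * ℘[L] (c * eichlerIntegral f (g • τ)) = Φ τ)
    {m : ℕ} (hΨm : (qExpansion h Ψ).coeff m ≠ 0) (hΨlt : ∀ n < m, (qExpansion h Ψ).coeff n = 0) :
    (∀ n < m, (qExpansion h Φ).coeff n = 0) ∧
      (qExpansion h Φ).coeff m = ℘[L] (c * modularSymbol f (((g 0 0 : ℤ) : ℚ) / ((g 1 0 : ℤ) : ℚ))) * (qExpansion h Ψ).coeff m :=
  qExpansion_coeff_eq_apply_mul_of_presentation hh f g hg c (L.analyticOnNhd_weierstrassP _ hz₀).continuousAt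
    hΦp hΦa hΨp hΨa hpres hΨm hΨlt

/-- **The `y`-coordinate**: the same with `w = ℘_Λ'`.  Fact-free. [cite: Manin1972, Prop. 1.4 and §1.5] -/
theorem qExpansion_coeff_eq_derivWeierstrassP_mul_of_presentation (hh : 0 < h) (f : CuspForm (Gamma0 N) 2) (L : PeriodPair)
    (g : SL(2, ℤ)) (hg : (g 1 0 : ℤ) ≠ 0) (c : ℂ)
    (hz₀ : c * modularSymbol f (((g 0 0 : ℤ) : ℚ) / ((g 1 0 : ℤ) : ℚ)) ∉ L.lattice)
    {Φ Ψ : ℍ → ℂ} (hΦp : Periodic (Φ ∘ ofComplex) h) (hΦa : AnalyticAt ℂ (cuspFunction h Φ) 0)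
    (hΨp : Periodic (Ψ ∘ ofComplex) h) (hΨa : AnalyticAt ℂ (cuspFunction h Ψ) 0)
    (hpres : ∀ᶠ τ : ℍ in atImInfty, Ψ τ * ℘'[L] (c * eichlerIntegral f (g • τ)) = Φ τ)
    {m : ℕ} (hΨm : (qExpansion h Ψ).coeff m ≠ 0) (hΨlt : ∀ n < m, (qExpansion h Ψ).coeff n = 0) :
    (∀ n < m, (qExpansion h Φ).coeff n = 0) ∧
      (qExpansion h Φ).coeff m = ℘'[L] (c * modularSymbol f (((g 0 0 : ℤ) : ℚ) / ((g 1 0 : ℤ) : ℚ))) * (qExpansion h Ψ).coeff m :=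
  qExpansion_coeff_eq_apply_mul_of_presentation hh f g hg c (L.analyticOnNhd_derivWeierstrassP _ hz₀).continuousAt
    hΦp hΦa hΨp hΨa hpres hΨm hΨlt

end Presentation

end Summit.BirchSwinnertonDyer.BirchSwinnertonDyer.Theorems.ManinLocalTwoThree.CuspValues

end
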